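import Summits.CriticalPhenomena.Ising3DConformalLimit.Theorems.PerfectScreeningGaussianLimitNotScreenedDepletionBound
import Summits.CriticalPhenomena.Ising3DConformalLimit.Theorems.PerfectScreeningGaussianLimitNotScreenedOneArmAsymptoticsEstimates
import HarnessLib

/-!
# Crux `CoulombImpliesNontrivial` (stmt-CriticalPhenomena-13885), line `merging-is-expected-screening`:
# the FIRST-MOMENT CEILING on the depletion of a two-point function by a free defect

Route PerfectScreening (r3). The line is complete (conditional assembly p124053) modulo ONE registered stub,
`stub_isingCapacityAxial` (spread `s`-dimensional free defects `C` DEPLETE `⟨σ_cσ_e⟩_{Λ_L,β_c}`: a LOWER bound on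
depletion). This file proves, sorry-free, the complementary UPPER bound — the only inequality on depletion the
random-current calculus yields — and what it forces on any witness of the stub:
* §1 `Current.restricted_pair_ceiling` (every finite graph, couplings `K ≥ 0`):
  `Z_{G∖T}[∅]·Z[zt]·Z[∅] ≤ Z_{G∖T}[zt]·Z[∅]² + Z_{G∖T}[∅]·∑_{v∈T} Z[tv]·Z[zv]`, i.e.
  `⟨σ_zσ_t⟩_Λ − ⟨σ_zσ_t⟩_{Λ∖T} ≤ ∑_{v∈T} ⟨σ_zσ_v⟩_Λ⟨σ_vσ_t⟩_Λ` (restricted switching with defect, ADCS15 Lemma 2.2 =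
  tree `ecurrentSumIn_empty_mul_ecurrentSum_pair`; on the defect event the SOURCED current's cluster of `z` meets
  `T` — `exists_mem_cluster_of_not_mem_connIn`; single ≤ double cluster; union bound; three-point identity, tree
  `tsum_epairWeight_mul_indicator_mem_cluster`);
* §2 `boxG_le_defectG_add_sum` (free box `Λ_L ⊂ ℤ³` at `β_c`): `boxG L c e ≤ defectG L C c e + ∑_{v∈C} boxG L c v·boxG L v e`;
* §3 `depletionWitness_ceiling` (`L → ∞`): `defectG ≤ (1 − c')·boxG` eventually ⟹ `c'·G(e−c) ≤ ∑_{v∈C} G(v−c)G(e−v)`;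
* §4 `far_witness_card_lower`: under the crux's antecedent `c₀/‖x‖ ≤ G` (+ infrared bound) a `θ`-separated witness
  has LINEAR mass `κ·c'·‖c − e‖ ≤ #C` — far witness classes of the stub need `s ≥ 1` in the Coulomb world, and with
  two-sided `r^{2−d}` laws the count `#C ≥ κc'R^{d−2}` kills the stub's `d ≥ 4` analogues while every lean of the
  line is `d`-uniform: a proof must inject a quantitative `d = 3` input (relevance `Δ_ε(3) < s`);
* §5 `stub_depletionCeiling` — the registered bookkeeping stub (§2 ∧ §4), `--supports stmt-CriticalPhenomena-13885`.
No definition, no named fact. References: Aizenman–Duminil-Copin–Sidoravicius, CMP 334 (2015) Lemma 2.2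
[AizenmanDuminilCopinSidoraviciusCMP2015]; Aizenman–Duminil-Copin, Ann. Math. 194 (2021) = arXiv:1912.07973 App. A
[AizenmanDuminilCopinAnnals2021]; Fröhlich–Simon–Spencer, CMP 50 (1976) [FrohlichSimonSpencer1976].
-/

noncomputable section

open Filter Topology Set Finset
open Literature.Probability.LatticeModels Literature.Probability.Percolation
open Summit.CriticalPhenomena.Ising3DConformalLimit.Cruxes.IsingEuclidUpgradeR4NonGaussian.FreeCovarianceDeltaDichotomy
  (boxG)
open Summit.CriticalPhenomena.Ising3DConformalLimit.Cruxes.GaussianLimitNotScreened.KaramataAmplitudeBlindMerging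
  (defectG toReal_offRatio_eq_defectG boxG_eq_toReal_div)
open Summit.CriticalPhenomena.Ising3DConformalLimit.Cruxes.GaussianLimitNotScreened.KaramataAmplitudeBlindMerging.OneArm
  (tendsto_boxG)
open scoped symmDiff ENNReal

namespace Summit.CriticalPhenomena.Ising3DConformalLimit.Cruxes.CoulombImpliesNontrivial.MergingIsExpectedScreening

/-! ## §1. General finite graph: the defect term of the restricted switching is at most the one-arm first moment -/

section FiniteGraph

variable {V : Type*} [Fintype V] [DecidableEq V] {G : SimpleGraph V} [DecidableRel G.Adj]
  {K : G.edgeFinset → ℝ}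

omit [DecidableEq V] in
/-- **Walk lifting.** If the cluster `C_n(z)` avoids `T`, every traced walk starting inside `C_n(z)` is a walk
of traced edges OFF `T` (edges of `offGraph G T`). [folklore] -/
theorem reachable_tracedIn_offGraph_of_walk (T : Finset V) (n : Current G) (z : V)
    (hT : ∀ v ∈ n.cluster z, v ∉ T) :
    ∀ {u t : V}, (openGraph n.traced).Walk u t → u ∈ n.cluster z →
      (openGraph (n.tracedIn (offGraph G T))).Reachable u t := by
  intro u t p
  induction p with
  | nil => exact fun _ => SimpleGraph.Reachable.refl _
  | @cons u w t hadj p ih =>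
    intro hu
    rw [openGraph_adj] at hadj
    obtain ⟨huw, hne⟩ := hadj
    have hw : w ∈ n.cluster z := by
      rw [Current.mem_cluster_iff] at hu ⊢
      exact hu.trans (SimpleGraph.Adj.reachable ((openGraph_adj _ _ _).2 ⟨huw, hne⟩))
    have huw' := huw
    simp only [Current.traced, Set.mem_setOf_eq] at huw'
    obtain ⟨hG, hpos⟩ := huw'
    have hoff : s(u, w) ∈ (offGraph G T).edgeSet :=
      mem_edgeSet_offGraph.2 ⟨SimpleGraph.mem_edgeFinset.1 hG, Current.edgeOff_mk.2 ⟨hT u hu, hT w hw⟩⟩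
    have hadj' : (openGraph (n.tracedIn (offGraph G T))).Adj u w := by
      rw [openGraph_adj]
      exact ⟨⟨hoff, huw⟩, hne⟩
    exact hadj'.reachable.trans (ih hw)

/-- **Blocking.** If the sourced current `n` (`∂n = {z} ∆ {t}`) does NOT connect `z` to `t` through edges off
`T`, then its cluster of `z` meets `T`. [cite: AizenmanDuminilCopinSidoraviciusCMP2015, Lemma 2.2] -/
theorem exists_mem_cluster_of_not_mem_connIn (T : Finset V) {n : Current G} {z t : V}
    (hs : n.sources = {z} ∆ {t}) (h : n ∉ Current.connIn (offGraph G T) z t) :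
    ∃ v ∈ T, v ∈ n.cluster z := by
  by_contra hno
  push Not at hno
  apply h
  rw [Current.mem_connIn_iff]
  have hzt : (openGraph n.traced).Reachable z t := by
    by_cases hzt : z = t
    · subst hzt; exact SimpleGraph.Reachable.refl _
    · exact Current.reachable_of_sources_eq hzt hs
  obtain ⟨p⟩ := hzt
  exact reachable_tracedIn_offGraph_of_walk T n z (fun v hv hvT => hno v hvT hv) p
    (Current.mem_cluster_self n z)

/-- **Step A.** The defect term of the restricted switching is at most `Z_{G∖T}[∅]` times the mass of the
sourced currents whose cluster of `z` meets `T`. [cite: AizenmanDuminilCopinSidoraviciusCMP2015, Lemma 2.2] -/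
theorem defect_le_mul_hitMass (T : Finset V) (z t : V) :
    ∑' p : Current G × Current G,
        (if Current.IsSupp (offGraph G T) p.1 ∧ p.1.sources = ∅ then p.1.eweight K else 0) *
          (if p.2.sources = {z} ∆ {t} then p.2.eweight K else 0) *
          (Current.connIn (offGraph G T) z t)ᶜ.indicator 1 (p.1 + p.2) ≤
      ecurrentSumIn (offGraph G T) K ∅ *
        ∑' m : Current G, (if m.sources = {z} ∆ {t} then m.eweight K else 0) *
          (if ∃ v ∈ T, v ∈ m.cluster z then 1 else 0) := by
  unfold ecurrentSumIn
  rw [tsum_mul_tsum_eq_tsum_prod]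
  refine ENNReal.tsum_le_tsum fun p => ?_
  rw [mul_assoc]
  refine mul_le_mul_right ?_ _
  by_cases h2 : p.2.sources = {z} ∆ {t}
  · rw [if_pos h2]
    refine mul_le_mul_right ?_ _
    by_cases hex : ∃ v ∈ T, v ∈ p.2.cluster z
    · rw [if_pos hex]
      by_cases hm : p.1 + p.2 ∈ (Current.connIn (offGraph G T) z t)ᶜ
      · rw [Set.indicator_of_mem hm, Pi.one_apply]
      · rw [Set.indicator_of_notMem hm]; exact zero_le_one
    · rw [if_neg hex]
      have hconn : p.2 ∈ Current.connIn (offGraph G T) z t := by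
        by_contra hc
        exact hex (exists_mem_cluster_of_not_mem_connIn T h2 hc)
      have hconn' : p.1 + p.2 ∈ Current.connIn (offGraph G T) z t :=
        Current.connIn_mono (offGraph G T) (le_add_self : p.2 ≤ p.1 + p.2) hconn
      rw [Set.indicator_of_notMem (Set.notMem_compl_iff.2 hconn')]
  · simp only [if_neg h2, zero_mul, le_refl]

/-- **Step B.** Single ≤ double cluster, union bound and the three-point identity: the hit mass times `Z[∅]` is at
most `∑_{v∈T} Z[tv]·Z[zv]`. [cite: AizenmanDuminilCopinAnnals2021, arXiv:1912.07973 Appendix A.2, Proposition A.3 (first display)] -/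
theorem hitMass_mul_empty_le_sum (hK : ∀ e, 0 ≤ K e) (T : Finset V) (z t : V) :
    (∑' m : Current G, (if m.sources = {z} ∆ {t} then m.eweight K else 0) *
          (if ∃ v ∈ T, v ∈ m.cluster z then 1 else 0)) * ecurrentSum K ∅ ≤
      ∑ v ∈ T, ecurrentSum K ({t} ∆ {v}) * ecurrentSum K ({z} ∆ {v}) := by
  unfold ecurrentSum
  rw [tsum_mul_tsum_eq_tsum_prod]
  calc ∑' p : Current G × Current G,
        (if p.1.sources = {z} ∆ {t} then p.1.eweight K else 0) *
            (if ∃ v ∈ T, v ∈ p.1.cluster z then 1 else 0) *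
          (if p.2.sources = ∅ then p.2.eweight K else 0)
      ≤ ∑' p : Current G × Current G, epairWeight K ({z} ∆ {t}) ∅ p *
          ∑ v ∈ T, (if v ∈ (p.1 + p.2).cluster z then 1 else 0 : ℝ≥0∞) := by
        refine ENNReal.tsum_le_tsum fun p => ?_
        rw [epairWeight_eq_mul, mul_right_comm]
        refine mul_le_mul_right ?_ _
        by_cases hex : ∃ v ∈ T, v ∈ p.1.cluster z
        · obtain ⟨v, hvT, hv⟩ := hex
          have hv' : v ∈ (p.1 + p.2).cluster z :=
            Current.cluster_mono (le_self_add : p.1 ≤ p.1 + p.2) z hv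
          refine le_trans ?_ (Finset.single_le_sum (f := fun v => (if v ∈ (p.1 + p.2).cluster z then 1 else 0 :
            ℝ≥0∞)) (fun _ _ => zero_le) hvT)
          rw [if_pos hv']
          split_ifs <;> simp
        · rw [if_neg hex]; exact zero_le
    _ = ∑ v ∈ T, ∑' p : Current G × Current G, epairWeight K ({z} ∆ {t}) ∅ p *
          (if v ∈ (p.1 + p.2).cluster z then 1 else 0 : ℝ≥0∞) := by
        simp_rw [Finset.mul_sum]
        exact Summable.tsum_finsetSum (fun _ _ => ENNReal.summable)
    _ = ∑ v ∈ T, ecurrentSum K ({t} ∆ {v}) * ecurrentSum K ({z} ∆ {v}) := by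
        refine Finset.sum_congr rfl fun v _ => ?_
        exact Current.tsum_epairWeight_mul_indicator_mem_cluster hK z t v

/-- **The first-moment ceiling, general graph** (restricted switching with defect + Steps A, B):
`Z_{G∖T}[∅]·Z[zt]·Z[∅] ≤ Z_{G∖T}[zt]·Z[∅]² + Z_{G∖T}[∅]·∑_{v∈T} Z[tv]·Z[zv]`, i.e. after division by
`Z_{G∖T}[∅]Z[∅]²`: `⟨σ_zσ_t⟩_Λ ≤ ⟨σ_zσ_t⟩_{Λ∖T} + ∑_{v∈T} ⟨σ_zσ_v⟩_Λ⟨σ_vσ_t⟩_Λ`. [cite: AizenmanDuminilCopinSidoraviciusCMP2015, Lemma 2.2] -/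
theorem Current.restricted_pair_ceiling (hK : ∀ e, 0 ≤ K e) (T : Finset V) (z t : V) :
    ecurrentSumIn (offGraph G T) K ∅ * ecurrentSum K ({z} ∆ {t}) * ecurrentSum K ∅ ≤
      ecurrentSumIn (offGraph G T) K ({z} ∆ {t}) * ecurrentSum K ∅ * ecurrentSum K ∅ +
        ecurrentSumIn (offGraph G T) K ∅ *
          ∑ v ∈ T, ecurrentSum K ({t} ∆ {v}) * ecurrentSum K ({z} ∆ {v}) := by
  rw [Current.ecurrentSumIn_empty_mul_ecurrentSum_pair (offGraph G T) hK z t, add_mul]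
  refine add_le_add le_rfl ?_
  calc _ ≤ ecurrentSumIn (offGraph G T) K ∅ *
        (∑' m : Current G, (if m.sources = {z} ∆ {t} then m.eweight K else 0) *
          (if ∃ v ∈ T, v ∈ m.cluster z then 1 else 0)) * ecurrentSum K ∅ :=
        mul_le_mul_left (defect_le_mul_hitMass T z t) _
    _ ≤ _ := by
        rw [mul_assoc]
        exact mul_le_mul_right (hitMass_mul_empty_le_sum hK T z t) _

/-- The same in the restricted-correlation form: `Z[zt]·Z[∅] ≤ (Z_{G∖T}[zt]/Z_{G∖T}[∅])·Z[∅]² + ∑_{v∈T} Z[tv]Z[zv]`.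
[cite: AizenmanDuminilCopinAnnals2021, arXiv:1912.07973 Appendix A.1, Lemma A.1] -/
theorem Current.pair_mul_empty_le_offRatio_add (hK : ∀ e, 0 ≤ K e) (T : Finset V) (z t : V) :
    ecurrentSum K ({z} ∆ {t}) * ecurrentSum K ∅ ≤
      Current.offRatio K T ({z} ∆ {t}) * ecurrentSum K ∅ * ecurrentSum K ∅ +
        ∑ v ∈ T, ecurrentSum K ({t} ∆ {v}) * ecurrentSum K ({z} ∆ {v}) := by
  set a := ecurrentSumIn (offGraph G T) K ∅ with ha
  have ha0 : a ≠ 0 := (lt_of_lt_of_le zero_lt_one (one_le_ecurrentSumIn_empty (offGraph G T) K)).ne'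
  have hatop : a ≠ ∞ := ecurrentSumIn_ne_top _ hK _
  have h := Current.restricted_pair_ceiling hK T z t
  rw [← ha, ← Current.offRatio_mul_ecurrentSumIn_empty hK T ({z} ∆ {t}), ← ha] at h
  have h' : a * (ecurrentSum K ({z} ∆ {t}) * ecurrentSum K ∅) ≤
      a * (Current.offRatio K T ({z} ∆ {t}) * ecurrentSum K ∅ * ecurrentSum K ∅ +
        ∑ v ∈ T, ecurrentSum K ({t} ∆ {v}) * ecurrentSum K ({z} ∆ {v})) := by
    calc a * (ecurrentSum K ({z} ∆ {t}) * ecurrentSum K ∅)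
        = a * ecurrentSum K ({z} ∆ {t}) * ecurrentSum K ∅ := by ring
      _ ≤ _ := h
      _ = _ := by ring
  exact (ENNReal.mul_le_mul_iff_right ha0 hatop).1 h'

end FiniteGraph

/-! ## §2. The free box `Λ_L ⊂ ℤ³` at `β_c`: `boxG ≤ defectG + ∑_{v∈C} boxG·boxG` -/

/-- **The first-moment ceiling in the box** (the stub's vocabulary): for `c, e ∈ Λ_L` and a defect `C ⊆ Λ_L`
avoiding them, `⟨σ_cσ_e⟩_{Λ_L} ≤ ⟨σ_cσ_e⟩_{Λ_L∖C} + ∑_{v∈C} ⟨σ_cσ_v⟩_{Λ_L}⟨σ_vσ_e⟩_{Λ_L}` (free b.c., `β_c(3)`):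
DEPLETION IS AT MOST THE ONE-ARM FIRST MOMENT `∑_{v∈C} G_L(c,v)G_L(v,e)/G_L(c,e)` of ADC21 Prop. A.3 over the defect.
[cite: AizenmanDuminilCopinAnnals2021, arXiv:1912.07973 Appendix A.2, Proposition A.3] -/
theorem boxG_le_defectG_add_sum (L : ℕ) {c e : Site 3} (hc : c ∈ box 3 L) (he : e ∈ box 3 L)
    {C : Finset (Site 3)} (hC : C ⊆ box 3 L) (hcC : c ∉ C) (heC : e ∉ C) :
    boxG L c e ≤ defectG L C c e + ∑ v ∈ C, boxG L c v * boxG L v e := by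
  classical
  -- box vertices and the constant coupling
  obtain ⟨c₀, rfl⟩ : ∃ c₀ : BoxVertex 3 L, (c₀ : Site 3) = c := ⟨⟨c, box_subset_box_succ 3 L hc⟩, rfl⟩
  obtain ⟨e₀, rfl⟩ : ∃ e₀ : BoxVertex 3 L, (e₀ : Site 3) = e := ⟨⟨e, box_subset_box_succ 3 L he⟩, rfl⟩
  obtain ⟨K, hKβ⟩ : ∃ K : (freeBoxGraph 3 L).edgeFinset → ℝ, K = fun _ => criticalBeta 3 := ⟨_, rfl⟩
  have hK : ∀ e', 0 ≤ K e' := fun _ => by rw [hKβ]; exact criticalBeta_nonneg 3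
  -- the defect as a set of box vertices
  set T : Finset (BoxVertex 3 L) := C.subtype (· ∈ box 3 (L + 1)) with hT
  have hTC : T.map (boxEmb 3 L) = C := by
    rw [hT, boxEmb, Finset.subtype_map]
    exact Finset.filter_true_of_mem fun v hv => box_subset_box_succ 3 L (hC hv)
  have hcT : c₀ ∉ T := fun h => hcC (by rw [hT, Finset.mem_subtype] at h; exact h)
  have heT : e₀ ∉ T := fun h => heC (by rw [hT, Finset.mem_subtype] at h; exact h)
  have hmemC : ∀ v ∈ T, (v : Site 3) ∈ C := fun v hv => by rw [hT, Finset.mem_subtype] at hv; exact hv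
  have h := Current.pair_mul_empty_le_offRatio_add hK T c₀ e₀
  have hZtop : ∀ S, ecurrentSum K S ≠ ∞ := fun S => ecurrentSum_ne_top hK S
  have hz0 : 0 < (ecurrentSum K ∅).toReal :=
    ENNReal.toReal_pos (ecurrentSum_empty_ne_zero K) (hZtop _)
  have hoR_top : Current.offRatio K T ({c₀} ∆ {e₀}) ≠ ∞ := by
    have h1 := Current.offRatio_pair_mul_le hK T c₀ e₀
    have h2 : Current.offRatio K T ({c₀} ∆ {e₀}) ≤ Current.offRatio K T ({c₀} ∆ {e₀}) * ecurrentSum K ∅ :=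
      le_mul_of_one_le_right' (one_le_ecurrentSum_empty K)
    exact ne_top_of_le_ne_top (hZtop _) (h2.trans h1)
  have hS_top : ∑ v ∈ T, ecurrentSum K ({e₀} ∆ {v}) * ecurrentSum K ({c₀} ∆ {v}) ≠ ∞ :=
    ENNReal.sum_ne_top.2 fun v _ => ENNReal.mul_ne_top (hZtop _) (hZtop _)
  have hB_top : Current.offRatio K T ({c₀} ∆ {e₀}) * ecurrentSum K ∅ * ecurrentSum K ∅ ≠ ∞ :=
    ENNReal.mul_ne_top (ENNReal.mul_ne_top hoR_top (hZtop _)) (hZtop _)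
  have hreal := ENNReal.toReal_mono (ENNReal.add_ne_top.2 ⟨hB_top, hS_top⟩) h
  rw [ENNReal.toReal_mul, ENNReal.toReal_add hB_top hS_top, ENNReal.toReal_mul, ENNReal.toReal_mul,
    ENNReal.toReal_sum (fun v _ => ENNReal.mul_ne_top (hZtop _) (hZtop _))] at hreal
  simp_rw [ENNReal.toReal_mul] at hreal
  -- the dictionary
  have hboxG : boxG L c₀ e₀ = (ecurrentSum K ({c₀} ∆ {e₀})).toReal / (ecurrentSum K ∅).toReal :=
    boxG_eq_toReal_div L K hKβ c₀ e₀ hc he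
  have hdef : (Current.offRatio K T ({c₀} ∆ {e₀})).toReal = defectG L C c₀ e₀ := by
    rw [toReal_offRatio_eq_defectG L K hKβ T c₀ e₀ hc he hcT heT, hTC]
  have hsum : ∑ v ∈ C, boxG L c₀ v * boxG L v e₀ =
      (∑ v ∈ T, (ecurrentSum K ({e₀} ∆ {v})).toReal * (ecurrentSum K ({c₀} ∆ {v})).toReal) /
        ((ecurrentSum K ∅).toReal * (ecurrentSum K ∅).toReal) := by
    rw [← hTC, Finset.sum_map, Finset.sum_div]
    refine Finset.sum_congr rfl fun v hv => ?_
    have hvbox : (v : Site 3) ∈ box 3 L := hC (hmemC v hv)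
    rw [boxEmb_apply, boxG_eq_toReal_div L K hKβ c₀ v hc hvbox, boxG_eq_toReal_div L K hKβ v e₀ hvbox he,
      symmDiff_comm ({v} : Finset (BoxVertex 3 L)) {e₀}, div_mul_div_comm, mul_comm]
  rw [hboxG, ← hdef, hsum]
  have hZ00 : 0 < (ecurrentSum K ∅).toReal * (ecurrentSum K ∅).toReal := mul_pos hz0 hz0
  calc (ecurrentSum K ({c₀} ∆ {e₀})).toReal / (ecurrentSum K ∅).toReal
      = (ecurrentSum K ({c₀} ∆ {e₀})).toReal * (ecurrentSum K ∅).toReal /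
          ((ecurrentSum K ∅).toReal * (ecurrentSum K ∅).toReal) := by
        rw [mul_div_mul_right _ _ hz0.ne']
    _ ≤ ((Current.offRatio K T ({c₀} ∆ {e₀})).toReal * (ecurrentSum K ∅).toReal * (ecurrentSum K ∅).toReal +
          ∑ v ∈ T, (ecurrentSum K ({e₀} ∆ {v})).toReal * (ecurrentSum K ({c₀} ∆ {v})).toReal) /
          ((ecurrentSum K ∅).toReal * (ecurrentSum K ∅).toReal) :=
        div_le_div_of_nonneg_right hreal hZ00.le
    _ = (Current.offRatio K T ({c₀} ∆ {e₀})).toReal +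
          (∑ v ∈ T, (ecurrentSum K ({e₀} ∆ {v})).toReal * (ecurrentSum K ({c₀} ∆ {v})).toReal) /
          ((ecurrentSum K ∅).toReal * (ecurrentSum K ∅).toReal) := by
        rw [add_div, mul_assoc, mul_div_assoc, div_self hZ00.ne', mul_one]

/-- **Depletion ≤ one-arm first moment** (ratio form of §2): if `G_L(c,e) > 0` then
`1 − defectG/boxG ≤ ∑_{v∈C} G_L(c,v)G_L(v,e)/G_L(c,e)`. [cite: AizenmanDuminilCopinAnnals2021, arXiv:1912.07973 Appendix A.2, Proposition A.3] -/
theorem depletion_le_oneArmFirstMoment (L : ℕ) {c e : Site 3} (hc : c ∈ box 3 L) (he : e ∈ box 3 L)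
    {C : Finset (Site 3)} (hC : C ⊆ box 3 L) (hcC : c ∉ C) (heC : e ∉ C) (hpos : 0 < boxG L c e) :
    1 - defectG L C c e / boxG L c e ≤ ∑ v ∈ C, boxG L c v * boxG L v e / boxG L c e := by
  have h := boxG_le_defectG_add_sum L hc he hC hcC heC
  have h1 : 1 - defectG L C c e / boxG L c e = (boxG L c e - defectG L C c e) / boxG L c e := by
    rw [sub_div, div_self hpos.ne']
  rw [h1, ← Finset.sum_div]
  exact div_le_div_of_nonneg_right (by linarith) hpos.le

/-! ## §3. `L → ∞`: the necessary condition on any depletion witness -/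

/-- **Ceiling on depletion witnesses, infinite volume.** If a finite defect `C ∌ c, e` depletes the free-box critical
two-point function by the fraction `c'` for all large `L` (the conclusion of `stub_isingCapacityAxial` at one `C`),
then `c'·G(e − c) ≤ ∑_{v∈C} G(v − c)·G(e − v)` for the infinite-volume critical two-point function
`G = criticalTwoPoint 3` (tree `tendsto_boxG`: `boxG L u v → ⟨σ_uσ_v⟩_{β_c}`). [cite: AizenmanDuminilCopinAnnals2021, arXiv:1912.07973 Appendix A.2, Proposition A.3] -/
theorem depletionWitness_ceiling {C : Finset (Site 3)} {c e : Site 3} (hcC : c ∉ C) (heC : e ∉ C) {c' : ℝ}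
    (hdep : ∀ᶠ L : ℕ in atTop, defectG L C c e ≤ (1 - c') * boxG L c e) :
    c' * criticalTwoPoint 3 (e - c) ≤ ∑ v ∈ C, criticalTwoPoint 3 (v - c) * criticalTwoPoint 3 (e - v) := by
  have hboxes : ∀ᶠ L : ℕ in atTop, c ∈ box 3 L ∧ e ∈ box 3 L ∧ ∀ v ∈ C, v ∈ box 3 L :=
    (eventually_mem_box c).and ((eventually_mem_box e).and ((eventually_all_finset C).2 fun v _ =>
      eventually_mem_box v))
  have hev : ∀ᶠ L : ℕ in atTop, c' * boxG L c e ≤ ∑ v ∈ C, boxG L c v * boxG L v e := by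
    filter_upwards [hboxes, hdep] with L ⟨hc, he, hCL⟩ hd
    have h := boxG_le_defectG_add_sum L hc he (fun v hv => hCL v hv) hcC heC
    linarith
  have hlim₁ : Tendsto (fun L : ℕ => c' * boxG L c e) atTop (𝓝 (c' * criticalTwoPoint 3 (e - c))) := by
    have h := (tendsto_boxG c e).const_mul c'
    rwa [criticalCorr_two_pair] at h
  have hlim₂ : Tendsto (fun L : ℕ => ∑ v ∈ C, boxG L c v * boxG L v e) atTop
      (𝓝 (∑ v ∈ C, criticalTwoPoint 3 (v - c) * criticalTwoPoint 3 (e - v))) := by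
    refine tendsto_finsetSum _ fun v _ => ?_
    have h := (tendsto_boxG c v).mul (tendsto_boxG v e)
    rwa [criticalCorr_two_pair, criticalCorr_two_pair] at h
  exact le_of_tendsto_of_tendsto hlim₁ hlim₂ hev

/-! ## §4. The Coulomb world: far witnesses have linear mass -/

/-- **Far depletion witnesses have LINEAR mass under the crux's antecedent.** If `c₀/‖x‖ ≤ G(x)` off the origin
(the Coulomb lower bound of `CoulombImpliesNontrivial`; the matching upper bound is the infrared bound
`exists_criticalTwoPoint_le_inv_pow`), then for every `θ > 0` there is `κ > 0` such that any finite defect `C`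
all of whose sites are `θ‖c − e‖`-far from both `c` and `e`, and which depletes `⟨σ_cσ_e⟩` by the fraction `c'` in
all large free boxes, has at least `κ·c'·‖c − e‖` sites. Consequently a witness exponent `s` of
`stub_isingCapacityAxial` serving FAR placements (e.g. the engine's own 'beyond' placement) must be `≥ 1` in the
Coulomb world; with two-sided `r^{2−d}` laws the same count (`#C ≥ κ c' R^{d−2}`) exceeds every `νRˢ`, `s < 2 ≤ d − 2`,
for `d ≥ 4`. [cite: FrohlichSimonSpencer1976, Theorem 3.1 (infrared bound)] -/
theorem far_witness_card_lower
    (hCou : ∃ c₀ : ℝ, 0 < c₀ ∧ ∀ x : Site 3, x ≠ 0 → c₀ / ‖x‖ ≤ criticalTwoPoint 3 x) {θ : ℝ} (hθ : 0 < θ) :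
    ∃ κ : ℝ, 0 < κ ∧ ∀ (C : Finset (Site 3)) (c e : Site 3) (c' : ℝ), c ≠ e →
      (∀ v ∈ C, θ * ‖c - e‖ ≤ ‖v - c‖ ∧ θ * ‖c - e‖ ≤ ‖e - v‖) →
      (∀ᶠ L : ℕ in atTop, defectG L C c e ≤ (1 - c') * boxG L c e) →
      κ * c' * ‖c - e‖ ≤ C.card := by
  obtain ⟨c₀, hc₀, hCou⟩ := hCou
  obtain ⟨C₀, hC₀, hIR⟩ := exists_criticalTwoPoint_le_inv_pow (d := 3) le_rfl
  refine ⟨c₀ * θ ^ 2 / (C₀ + 1) ^ 2, by positivity, fun C c e c' hce hfar hdep => ?_⟩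
  set R : ℝ := ‖c - e‖ with hR
  have hRpos : 0 < R := by rw [hR, norm_pos_iff, sub_ne_zero]; exact hce
  have hθR : 0 < θ * R := mul_pos hθ hRpos
  -- `c, e ∉ C` (they are `0`-far from themselves)
  have hcC : c ∉ C := fun h => by
    have := (hfar c h).1; rw [sub_self, norm_zero] at this; linarith
  have heC : e ∉ C := fun h => by
    have := (hfar e h).2; rw [sub_self, norm_zero] at this; linarith
  by_cases hc' : c' ≤ 0
  · calc c₀ * θ ^ 2 / (C₀ + 1) ^ 2 * c' * ‖c - e‖ ≤ 0 :=
          mul_nonpos_of_nonpos_of_nonneg (mul_nonpos_of_nonneg_of_nonpos (by positivity) hc') (norm_nonneg _)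
      _ ≤ _ := Nat.cast_nonneg _
  push Not at hc'
  have hceil := depletionWitness_ceiling hcC heC hdep
  -- the infrared bound on each summand: `G(v - c) G(e - v) ≤ (C₀+1)²/(θR)²`
  have hIR' : ∀ x : Site 3, x ≠ 0 → criticalTwoPoint 3 x ≤ (C₀ + 1) / ‖x‖ := fun x hx => by
    have h := hIR x hx
    simp only [Nat.reduceSub, pow_one] at h
    rw [Site.norm_eq_supNorm, div_eq_mul_inv]
    have hn : (0 : ℝ) < Site.supNorm x := by
      have : Site.supNorm x ≠ 0 := fun h0 => hx (Site.supNorm_eq_zero_iff.1 h0)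
      exact_mod_cast Nat.pos_of_ne_zero this
    exact h.trans (mul_le_mul_of_nonneg_right (by linarith) (inv_nonneg.2 hn.le))
  have hterm : ∀ v ∈ C, criticalTwoPoint 3 (v - c) * criticalTwoPoint 3 (e - v) ≤
      ((C₀ + 1) / (θ * R)) * ((C₀ + 1) / (θ * R)) := by
    intro v hv
    obtain ⟨h1, h2⟩ := hfar v hv
    have hvc : v - c ≠ 0 := fun h0 => by rw [h0, norm_zero] at h1; linarith
    have hev : e - v ≠ 0 := fun h0 => by rw [h0, norm_zero] at h2; linarith
    have b1 : criticalTwoPoint 3 (v - c) ≤ (C₀ + 1) / (θ * R) :=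
      (hIR' _ hvc).trans (div_le_div_of_nonneg_left (by linarith) hθR h1)
    have b2 : criticalTwoPoint 3 (e - v) ≤ (C₀ + 1) / (θ * R) :=
      (hIR' _ hev).trans (div_le_div_of_nonneg_left (by linarith) hθR h2)
    exact mul_le_mul b1 b2 (criticalTwoPoint_nonneg' _) (by positivity)
  have hsum : ∑ v ∈ C, criticalTwoPoint 3 (v - c) * criticalTwoPoint 3 (e - v) ≤
      C.card * (((C₀ + 1) / (θ * R)) * ((C₀ + 1) / (θ * R))) := by
    have := Finset.sum_le_sum hterm
    rwa [Finset.sum_const, nsmul_eq_mul] at this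
  -- the Coulomb lower bound at the pair: `c₀/R ≤ G(e - c)`
  have hlow : c₀ / R ≤ criticalTwoPoint 3 (e - c) := by
    have h := hCou (e - c) (sub_ne_zero.2 hce.symm)
    rwa [hR, ← norm_neg, neg_sub]
  have key : c' * (c₀ / R) ≤ C.card * (((C₀ + 1) / (θ * R)) * ((C₀ + 1) / (θ * R))) :=
    ((mul_le_mul_of_nonneg_left hlow hc'.le).trans hceil).trans hsum
  -- arithmetic: `c' c₀ / R ≤ #C (C₀+1)²/(θR)²` ⇒ `c₀ θ²/(C₀+1)² · c' · R ≤ #C`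
  have hC1 : (0 : ℝ) < (C₀ + 1) ^ 2 := by positivity
  rw [show c₀ * θ ^ 2 / (C₀ + 1) ^ 2 * c' * R = (c' * (c₀ / R)) * (θ * R) ^ 2 / (C₀ + 1) ^ 2 by
    field_simp]
  rw [div_le_iff₀ hC1]
  calc c' * (c₀ / R) * (θ * R) ^ 2 ≤ C.card * (((C₀ + 1) / (θ * R)) * ((C₀ + 1) / (θ * R))) * (θ * R) ^ 2 :=
        mul_le_mul_of_nonneg_right key (by positivity)
    _ = C.card * (C₀ + 1) ^ 2 := by field_simp

/-! ## §5. The registered bookkeeping stub -/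

/-- **Registered bookkeeping stub `stub_depletionCeiling`** (crux stmt-CriticalPhenomena-13885, line
`merging-is-expected-screening`): the first-moment ceiling on depletion in the free box (§2) together with its
Coulomb-world consequence (§4). [cite: AizenmanDuminilCopinAnnals2021, arXiv:1912.07973 Appendix A.2, Proposition A.3] -/
theorem stub_depletionCeiling :
    (∀ (L : ℕ) (c e : Site 3) (C : Finset (Site 3)), c ∈ box 3 L → e ∈ box 3 L → C ⊆ box 3 L →
        c ∉ C → e ∉ C → boxG L c e ≤ defectG L C c e + ∑ v ∈ C, boxG L c v * boxG L v e) ∧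
      ((∃ c₀ : ℝ, 0 < c₀ ∧ ∀ x : Site 3, x ≠ 0 → c₀ / ‖x‖ ≤ criticalTwoPoint 3 x) →
        ∀ θ : ℝ, 0 < θ → ∃ κ : ℝ, 0 < κ ∧ ∀ (C : Finset (Site 3)) (c e : Site 3) (c' : ℝ), c ≠ e →
          (∀ v ∈ C, θ * ‖c - e‖ ≤ ‖v - c‖ ∧ θ * ‖c - e‖ ≤ ‖e - v‖) →
          (∀ᶠ L : ℕ in atTop, defectG L C c e ≤ (1 - c') * boxG L c e) →
          κ * c' * ‖c - e‖ ≤ C.card) :=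
  ⟨fun L _ _ _ hc he hC hcC heC => boxG_le_defectG_add_sum L hc he hC hcC heC,
    fun hCou _ hθ => far_witness_card_lower hCou hθ⟩

end Summit.CriticalPhenomena.Ising3DConformalLimit.Cruxes.CoulombImpliesNontrivial.MergingIsExpectedScreening

end
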